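/-
Copyright (c) 2026. All rights reserved.
Released under Apache 2.0 license as described in the file LICENSE.
-/
import Literature.AlgebraicGeometry.Pohlmann1968.DegenerateCMTypesAbelianCMFieldExponentFourTimesPrime
import Literature.NumberTheory.ComplexMultiplication.DegenerateCMTypesAbelianKernelsIndexFourMulPrimePower
import HarnessLib

/-!
# ABELIAN CM fields whose Galois group has exponent `4p^k` (ONE odd prime `p`, `2`-exponent `≤ 4`, `k` ARBITRARY): the nondegeneracy criterion
# — Weil type over no imaginary quadratic subfield, halving no cyclic quartic CM subfield, level of exponent `p` over no cyclic CM subfield of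
# degree divisible by `p` — and the Hodge conjecture for all powers off the three lists; `ℚ(ζ₁₀₉)`

Topic `Literature/AlgebraicGeometry/Pohlmann1968` (namespace `Literature.AlgebraicGeometry.Pohlmann1968.ExponentFourTimesPrimePower`); cell
`pub-hodgecm2` (COR-CM), KEPT Literature lane `lit-deligne-3` gen 64, file F64g — the `j`-free synthesis of the lane's exponent files
(`ExponentTwicePrime`, `…Square`, `ExponentFourTimesPrime`, `…Square`): those give the RANK FORMULA with its `φ`-weights for `k ≤ 2`; this file
gives the NONDEGENERACY CRITERION for every `k`, with three clauses and no sum over the exponent, from the tree's "one surviving character per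
admissible kernel" (`AbelianKernels.typeRank_eq_iff_forall_exists_ker`) and the four kernel decisions (index `2`, `4`, `2p^{j+1}`, `4p^{j+1}` —
the last being F64d `…IndexFourMulPrimePower`).  KERNEL ONLY: theorems; no `def`, no named fact, no instance, no notation (D-0014 ∕ D-0026 net
debt `0`).  HC_CM is NOT proved here or anywhere in the lane.

## Mathematics

T. Kubota [Kubota1965], §4 LEMMA 2: `Φ` is nondegenerate iff no odd character of `G = Gal(K/ℚ)` vanishes on `S = {g : σ_g ∈ Φ}`; grouped by
kernels (S. P. White): iff for every subgroup `H ∌ ρ` with `G/H` cyclic some (equivalently every) character with kernel `H` does not vanish on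
`S`.  If `g^{4p^k} = 1` on `G` then `[G:H] ∈ {2, 4, 2p^{j+1}, 4p^{j+1}}` (`index_eq_of_isCyclic_quotient`), and the characters of kernel `H` vanish
on `S` iff, respectively: `S` splits `H` evenly (Dodson [Dodson1984] §3.1.1); `S` halves every coset of `H` (Yanai–Gordon [Gordon1999HodgeAVSurvey]
9.4.3); `S` is EQUIDISTRIBUTED along the subgroup of order `p` of `G/H` — `#(S ∩ gxH) = #(S ∩ gH)` for all `g` and all `x` with `x^p ∈ H`
(Hazama [Hazama2003CyclicCM] Lemma 4.6.1, Dodson [Dodson1987] Prop. 4.4; the same condition at `2p^{j+1}` and `4p^{j+1}`).  Read on the lattice of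
subfields (`H = Gal(K/F)`, `G/H = Gal(F/ℚ)`; equidistribution = LEVELNESS of `Φ` over `F`: for every `σ ∈ Gal(F/ℚ)` with `σ^p = 1` and every
`τ : F → ℂ`, `#{φ ∈ Φ : φ|_F = τ ∘ σ} = #{φ ∈ Φ : φ|_F = τ}`):

  `Φ` NONDEGENERATE ⟺ (i) `Φ` balanced over no imaginary quadratic `F ⊆ K`; (ii) no CM `F ⊆ K` with `Gal(F/ℚ) ≅ ℤ/4` has every embedding
  with `[K:F]/2` extensions in `Φ`; (iii) `Φ` level of exponent `p` over no CM `F ⊆ K` with `Gal(F/ℚ)` cyclic and `p ∣ [F:ℚ]`.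

* §1 GROUP LEVEL: **`index_eq_of_isCyclic_quotient`**, **`typeRank_eq_iff`** (the three clauses on subgroups).
* §2 FIELD LEVEL: `isNondegenerate_iff` (on `Gal`), **`isNondegenerate_iff_forall_intermediateField`** (THE INTRINSIC CRITERION displayed above),
  `not_isNondegenerate_of_level_of_isCyclic` (a level cyclic CM subfield of degree divisible by `p` makes the type degenerate).
* §3 ABELIAN VARIETIES: `B•(Aⁿ) ⊗ ℂ = D•(Aⁿ) ⊗ ℂ` and the Hodge conjecture for every power of every realisation of a type satisfying (i)–(iii)
  (**`hodgeConjectureFor_pow_of_forall_intermediateField`**, `hodgeClassSpan_pow_eq_divisorClassesSpan_of_forall_intermediateField`,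
  `not_exists_exceptional_pow_of_forall_intermediateField`) — UNCONDITIONAL.
* §4 CYCLOTOMIC FIELDS with `u^{4p^k} = 1` on `(ℤ/q)ˣ` (`isNondegenerate_iff_of_isCyclotomicExtension`,
  `hodgeConjectureFor_pow_of_forall_of_isCyclotomicExtension`) and the level `109` (`(ℤ/109)ˣ ≅ ℤ/108 = ℤ/4 × ℤ/27`, `k = 3`, beyond the
  `k ≤ 2` files): `units_pow_oneHundredEight_oneHundredNine` (Euler), **`hodgeConjectureFor_pow_of_forall_oneHundredNine`** (CM `54`-folds).

SCOPE.  Applies to every abelian CM field whose Galois group is `(ℤ/2)^r × (ℤ/4)^s × P` with `P` an abelian `p`-group — among cyclotomic fields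
`ℚ(ζ_N)`: all the lane's levels of `φ(N) ∈ {24, 36, 40, 44, 48}` and further `81, 109, 111, 135, 163, 171, 189, 243, 324, …`; NOT the fields with two
odd primes in the exponent (`ℚ(ζ₃₁)`, `ℚ(ζ₄₃)`, …: `CyclicTwoOddPrimes`) nor `2`-exponent `≥ 8` (`ℚ(ζ₁₇)`, `ℚ(ζ₄₁)`, …: `AbelianTwoPower`,
`CyclicTwoPowerTimesPrime`).

PRESEARCH (lane rule): as for the neighbours — the criterion is Kubota's Lemma 2 by kernels with the four printed ∕ tree vanishing criteria, read
through the Galois correspondence; not found as printed (corpus hybrid + vector; galaxy «degenerate CM type | nondegenerate CM type», all stars);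
recorded as the lane's own elementary theorem with those citations.

HONEST REGISTER.  Unconditional and elementary given the tree's Kubota ∕ Hazama ∕ Pohlmann theorems.  Nothing is claimed for the DEGENERATE types
(HC open in print beyond Markman's cases); HC_CM is NOT proved and not used.

## References

* [Kubota1965] T. Kubota, *On the field extension by complex multiplication*, Trans. AMS 118 (1965), §4 Lemma 2.
* [White1993SporadicCycles] S. P. White, *Sporadic cycles on CM abelian varieties*, Compositio Math. 88 (1993), §4, proof of Lemma 3 (p. 131).
* [Dodson1984] B. Dodson, *The structure of Galois groups of CM-fields*, Trans. AMS 283 (1984), §3.1.1 Theorem.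
* [Dodson1987] B. Dodson, *On the Mumford–Tate group of an abelian variety with complex multiplication*, J. Algebra 111 (1987), Prop. 4.4.
* [Hazama2003CyclicCM] F. Hazama, J. Math. Sci. Univ. Tokyo 10 (2003), Prop. 4.3, Lemma 4.6.1.
* [Gordon1999HodgeAVSurvey] B. B. Gordon, *A survey of the Hodge conjecture for abelian varieties*, 5.13 (ii), Thm. 6.4, §9.3, 9.4.1, 9.4.3.
* [Yanai2015IndexDegeneracy] H. Yanai, *On the index of degeneracy of a CM-type*, Thm. 4.1 (proof, p. 818).
* [MilneFT2022] J. S. Milne, *Fields and Galois Theory*, Thm. 3.16–3.17.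
* [Washington1997] L. C. Washington, *Introduction to Cyclotomic Fields*, Ch. 2, Thm. 2.5.
* [Deligne2000] P. Deligne, *The Hodge conjecture* (Clay, 2000), §1.

## Provenance

Cell `pub-hodgecm2` (COR-CM), KEPT Literature lane `lit-deligne-3` gen 64 (claim ABELIAN-ONE-ODD-PRIME-CRITERION; count-neutral, own lane), file F64g;
neighbours cited by name, nothing restated: `DegenerateCMTypesAbelianKernels{,IndexFour,IndexFourMulPrimePower}`, `…AbelianCMFieldCyclicSubfields`
(`card_filter_mem_eq_iff_balanced`), `…CyclicQuarticSubfields` (`forall_two_mul_card_filter_eq_iff_forall_fibre`), `…ExponentTwicePrime`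
(`forall_card_filter_eq_iff_level`), `…ExponentFourTimesPrime` (`cm_abelian_pow_eq_one_of_isCyclotomicExtension`), `NondegenerateCMTypeDivisorClasses`.
Theorems only; net Literature debt 0.
-/

noncomputable section

open scoped BigOperators NumberField IsMulCommutative Classical
open NumberField IntermediateField

namespace Literature.AlgebraicGeometry.Pohlmann1968

namespace ExponentFourTimesPrimePower

open Literature.NumberTheory.ComplexMultiplication
open Literature.NumberTheory.ComplexMultiplication.CMNumbers
open Literature.AlgebraicGeometry.Motives (CMType)
open Literature.AlgebraicGeometry.Pohlmann1968.CyclicTwoOddPrimes (isCMTypeWith_galType cmTypeRank_eq_typeRank_galType)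
open Literature.AlgebraicGeometry.Pohlmann1968.AbelianKernels
open Literature.AlgebraicGeometry.Pohlmann1968.ExponentTwicePrime (forall_card_filter_eq_iff_level)
open Literature.AlgebraicGeometry.Pohlmann1968.ExponentFourTimesPrime (cm_abelian_pow_eq_one_of_isCyclotomicExtension)

/-! ## §1 Group level: in exponent `4p^k` the admissible kernels have index `2`, `4`, `2p^{j+1}` or `4p^{j+1}`, and each is decided -/

section Group

variable {G : Type*} [CommGroup G] {p k : ℕ}

/-- **In a commutative group with `g^{4p^k} = 1` for all `g` (`p` an odd prime), a subgroup `H` missing an involution `ρ` and with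
CYCLIC quotient has index `2`, `4`, `2p^{j+1}` or `4p^{j+1}` for some `j`**: `|G/H|` divides `4p^k` and is even.
[cite: Kubota1965, §4 Lemma 2] [cite: White1993SporadicCycles, §4, proof of Lemma 3 (p. 131)] -/
theorem index_eq_of_isCyclic_quotient [hp : Fact p.Prime] (hp2 : p ≠ 2) (hexp : ∀ g : G, g ^ (4 * p ^ k) = 1)
    {H : Subgroup G} {ρ : G} (hρH : ρ ∉ H) (hρ2 : ρ * ρ = 1) (hcyc : IsCyclic (G ⧸ H)) :
    H.index = 2 ∨ H.index = 4 ∨ ∃ j : ℕ, H.index = 2 * p ^ (j + 1) ∨ H.index = 4 * p ^ (j + 1) := by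
  haveI := hcyc
  have hdvd : H.index ∣ 4 * p ^ k := by
    rw [Subgroup.index_eq_card, ← IsCyclic.exponent_eq_card]
    exact Monoid.exponent_dvd_of_forall_pow_eq_one fun q => QuotientGroup.induction_on q fun g => by
      rw [← QuotientGroup.mk_pow, hexp, QuotientGroup.mk_one]
  have hρ1 : (ρ : G ⧸ H) ≠ 1 := fun h => hρH ((QuotientGroup.eq_one_iff ρ).1 h)
  have hord : orderOf (ρ : G ⧸ H) = 2 := by
    haveI : Fact (Nat.Prime 2) := ⟨Nat.prime_two⟩
    refine orderOf_eq_prime ?_ hρ1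
    rw [pow_two, ← QuotientGroup.mk_mul, hρ2, QuotientGroup.mk_one]
  have h2 : 2 ∣ H.index := by rw [Subgroup.index_eq_card, ← hord]; exact orderOf_dvd_natCard _
  have hp2' : ¬ 2 ∣ p := fun h => hp2 ((Nat.prime_dvd_prime_iff_eq Nat.prime_two hp.out).1 h).symm
  obtain ⟨d₁, d₂, hd₁, hd₂, hdeq⟩ := Nat.dvd_mul.1 hdvd
  have hd₁' : d₁ ∣ 2 ^ 2 := by rw [show (2 : ℕ) ^ 2 = 4 by norm_num]; exact hd₁
  obtain ⟨a, ha, rfl⟩ := (Nat.dvd_prime_pow Nat.prime_two).1 hd₁'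
  obtain ⟨i, hi, rfl⟩ := (Nat.dvd_prime_pow hp.out).1 hd₂
  have hpi : ¬ 2 ∣ p ^ i := fun h => hp2' (Nat.Prime.dvd_of_dvd_pow Nat.prime_two h)
  interval_cases a
  · exfalso; rw [← hdeq, pow_zero, one_mul] at h2; exact hpi h2
  · rcases i with _ | j
    · exact Or.inl (by rw [← hdeq, pow_zero, pow_one, mul_one])
    · exact Or.inr (Or.inr ⟨j, Or.inl (by rw [← hdeq, pow_one])⟩)
  · rcases i with _ | j
    · exact Or.inr (Or.inl (by rw [← hdeq, pow_zero, mul_one]; norm_num))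
    · exact Or.inr (Or.inr ⟨j, Or.inr (by rw [← hdeq]; norm_num)⟩)

variable [Fintype G] [DecidableEq G]

/-- **NONDEGENERACY CRITERION IN EXPONENT `4p^k` (group level; `k` arbitrary).**  Let `G` be a finite commutative group with `g^{4p^k} = 1`
for all `g` (`p` an odd prime: ONE odd prime in the exponent, `2`-part of exponent `≤ 4`), `ρ ∈ G`, `T` a CM type.  Then `T` is
NONDEGENERATE (`rank(T) = |G|/2 + 1`) iff
(i) no index-`2` subgroup `H ∌ ρ` splits `T` evenly,
(ii) no index-`4` subgroup `H ∌ ρ` with cyclic quotient is met by `T` in half of every coset, and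
(iii) `T` is EQUIDISTRIBUTED (`#(T ∩ gxH) = #(T ∩ gH)` for all `g` and all `x` with `x^p ∈ H`) at NO subgroup `H ∌ ρ` with cyclic quotient
and `p ∣ [G:H]`.
One surviving character per admissible kernel (tree `AbelianKernels.typeRank_eq_iff_forall_exists_ker`); the admissible kernels have index
`2, 4, 2p^{j+1}, 4p^{j+1}` (`index_eq_of_isCyclic_quotient`) and are decided by the tree's `…iff_of_index_two`, `…iff_of_index_four`,
`…equidistributed_of_index` (`2p^{j+1}`) and the lane's `…equidistributed_of_index_four_mul_primePow` (`4p^{j+1}`).  No sum over `j` is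
needed for the criterion (the RANK formulas with their `φ`-weights are the neighbours `ExponentTwicePrime{,Square}`,
`ExponentFourTimesPrime{,Square}` for `k ≤ 2`). [cite: Kubota1965, §4 Lemma 2] [cite: Hazama2003CyclicCM, Prop. 4.3 and Lemma 4.6.1]
[cite: Dodson1984, §3.1.1 Theorem] [cite: Dodson1987, Prop. 4.4] [cite: Gordon1999HodgeAVSurvey, 9.4.3] -/
theorem typeRank_eq_iff [hp : Fact p.Prime] (hp2 : p ≠ 2) {ρ : G} {T : Finset G}
    (h : IsCMTypeWith ρ (T : Set G)) (hexp : ∀ g : G, g ^ (4 * p ^ k) = 1) :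
    typeRank G (T : Set G) = Fintype.card G / 2 + 1 ↔
      (∀ H : Subgroup G, ρ ∉ H → H.index = 2 →
          (T.filter fun s => s ∈ H).card ≠ (T.filter fun s => s ∉ H).card) ∧
      (∀ H : Subgroup G, ρ ∉ H → H.index = 4 → IsCyclic (G ⧸ H) →
          ¬ ∀ g : G, 2 * ((T.filter fun s => g⁻¹ * s ∈ H).card) = Nat.card H) ∧
      (∀ H : Subgroup G, ρ ∉ H → IsCyclic (G ⧸ H) → p ∣ H.index →
          ¬ ∀ x : G, x ^ p ∈ H → ∀ g : G,
            (T.filter fun s => (g * x)⁻¹ * s ∈ H).card = (T.filter fun s => g⁻¹ * s ∈ H).card) := by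
  have hρ2 : ρ * ρ = 1 := by simpa [smul_eq_mul] using h.invol (1 : G)
  have hp2dvd : ¬ p ∣ 2 := fun hd => hp2 ((Nat.prime_dvd_prime_iff_eq hp.out Nat.prime_two).1 hd)
  have hp4dvd : ¬ p ∣ 4 := fun hd => by
    have : p ∣ 2 ^ 2 := by rw [show (2 : ℕ) ^ 2 = 4 by norm_num]; exact hd
    exact hp2dvd (Nat.Prime.dvd_of_dvd_pow hp.out this)
  rw [CyclicCMType.AbelianKernels.typeRank_eq_iff_forall_exists_ker h]
  constructor
  · intro hall
    refine ⟨fun H hρH hidx hbal => ?_, fun H hρH hidx hcyc hhalf => ?_, fun H hρH hcyc hpd hE => ?_⟩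
    · haveI : Fact (Nat.Prime 2) := ⟨Nat.prime_two⟩
      have hcyc : IsCyclic (G ⧸ H) := isCyclic_of_prime_card (p := 2) (by rw [← Subgroup.index_eq_card, hidx])
      obtain ⟨χ, hker, hne⟩ := hall H hρH hcyc
      exact hne ((CyclicCMType.AbelianKernels.forall_sum_char_eq_zero_iff_of_index_two hρ2 hρH hidx T).2 hbal χ hker)
    · obtain ⟨χ, hker, hne⟩ := hall H hρH hcyc
      exact hne ((CyclicCMType.AbelianKernels.forall_sum_char_eq_zero_iff_of_index_four h hρH hidx hcyc).2 hhalf χ hker)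
    · obtain ⟨χ, hker, hne⟩ := hall H hρH hcyc
      rcases index_eq_of_isCyclic_quotient hp2 hexp hρH hρ2 hcyc with hi | hi | ⟨j, hi | hi⟩
      · exact hp2dvd (hi ▸ hpd)
      · exact hp4dvd (hi ▸ hpd)
      · exact hne ((CyclicCMType.AbelianKernels.forall_sum_char_eq_zero_iff_equidistributed_of_index
          hp2 h hρH hcyc hi).2 hE χ hker)
      · exact hne ((CyclicCMType.AbelianKernels.forall_sum_char_eq_zero_iff_equidistributed_of_index_four_mul_primePow
          hp2 h hρH hcyc hi).2 hE χ hker)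
  · rintro ⟨h₂, h₄, hP⟩ H hρH hcyc
    by_contra hno
    push Not at hno
    have hvan : ∀ χ : AddChar (Additive G) ℂ, (∀ g : G, χ (Additive.ofMul g) = 1 ↔ g ∈ H) →
        ∑ s ∈ T, χ (Additive.ofMul s) = 0 := hno
    rcases index_eq_of_isCyclic_quotient hp2 hexp hρH hρ2 hcyc with hi | hi | ⟨j, hi | hi⟩
    · exact h₂ H hρH hi ((CyclicCMType.AbelianKernels.forall_sum_char_eq_zero_iff_of_index_two hρ2 hρH hi T).1 hvan)
    · exact h₄ H hρH hi hcyc ((CyclicCMType.AbelianKernels.forall_sum_char_eq_zero_iff_of_index_four h hρH hi hcyc).1 hvan)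
    · exact hP H hρH hcyc (by rw [hi]; exact dvd_mul_of_dvd_right (dvd_pow_self p j.succ_ne_zero) 2)
        ((CyclicCMType.AbelianKernels.forall_sum_char_eq_zero_iff_equidistributed_of_index hp2 h hρH hcyc hi).1 hvan)
    · exact hP H hρH hcyc (by rw [hi]; exact dvd_mul_of_dvd_right (dvd_pow_self p j.succ_ne_zero) 4)
        ((CyclicCMType.AbelianKernels.forall_sum_char_eq_zero_iff_equidistributed_of_index_four_mul_primePow
          hp2 h hρH hcyc hi).1 hvan)

end Group

/-! ## §2 Abelian CM fields with Galois group of exponent `4p^k`: the nondegeneracy criterion on the lattice of subfields -/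

section Field

variable {K : Type} [Field K] [NumberField K] [IsCMField K] [IsAbelianGalois ℚ K] {p k : ℕ}

/-- **The criterion on `Gal(K/ℚ)`** (`S = {g : σ_g ∈ Φ}`): `Φ` nondegenerate iff the three clauses of `typeRank_eq_iff` hold for the subgroups
of `Gal(K/ℚ)` missing complex conjugation. [cite: Kubota1965, §4 Lemma 2] [cite: Hazama2003CyclicCM, Prop. 4.3] [cite: Dodson1984, §3.1.1 Theorem]
[cite: Gordon1999HodgeAVSurvey, 9.4.3] -/
theorem isNondegenerate_iff [Fact p.Prime] (hp2 : p ≠ 2) (φ₀ : K →+* ℂ)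
    (hexp : ∀ g : K ≃ₐ[ℚ] K, g ^ (4 * p ^ k) = 1) (Φ : CMType K) :
    IsNondegenerate Φ ↔
      (∀ H : Subgroup (K ≃ₐ[ℚ] K), (conjGal : K ≃ₐ[ℚ] K) ∉ H → H.index = 2 →
          ((Finset.univ.filter fun g : K ≃ₐ[ℚ] K => embOf φ₀ g ∈ Φ.1).filter fun s => s ∈ H).card ≠ ((Finset.univ.filter fun g : K ≃ₐ[ℚ] K => embOf φ₀ g ∈ Φ.1).filter fun s => s ∉ H).card) ∧
      (∀ H : Subgroup (K ≃ₐ[ℚ] K), (conjGal : K ≃ₐ[ℚ] K) ∉ H → H.index = 4 → IsCyclic ((K ≃ₐ[ℚ] K) ⧸ H) →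
          ¬ ∀ g : K ≃ₐ[ℚ] K, 2 * (((Finset.univ.filter fun g : K ≃ₐ[ℚ] K => embOf φ₀ g ∈ Φ.1).filter fun s => g⁻¹ * s ∈ H).card) = Nat.card H) ∧
      (∀ H : Subgroup (K ≃ₐ[ℚ] K), (conjGal : K ≃ₐ[ℚ] K) ∉ H → IsCyclic ((K ≃ₐ[ℚ] K) ⧸ H) → p ∣ H.index →
          ¬ ∀ x : K ≃ₐ[ℚ] K, x ^ p ∈ H → ∀ g : K ≃ₐ[ℚ] K,
            ((Finset.univ.filter fun g : K ≃ₐ[ℚ] K => embOf φ₀ g ∈ Φ.1).filter fun s => (g * x)⁻¹ * s ∈ H).card = ((Finset.univ.filter fun g : K ≃ₐ[ℚ] K => embOf φ₀ g ∈ Φ.1).filter fun s => g⁻¹ * s ∈ H).card) := by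
  rw [Pohlmann1968.isNondegenerate_iff Φ, cmTypeRank_eq_typeRank_galType Φ φ₀, ← card_gal_eq_finrank φ₀]
  exact typeRank_eq_iff hp2 (isCMTypeWith_galType (AbelianCMFieldExistence.apply_conjGal_eq φ₀) Φ) hexp

omit [IsCMField K] in
/-- `[K^H : ℚ] = [G : H]` read both ways, with the cyclicity of `Gal(K^H/ℚ) ≅ G/H`. [cite: MilneFT2022, Thm. 3.16] -/
private theorem finrank_fixedField_eq_index₄ₚₖ (H : Subgroup (K ≃ₐ[ℚ] K)) : Module.finrank ℚ (fixedField H) = H.index :=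
  (index_eq_finrank_fixedField H).symm

/-- **NONDEGENERACY CRITERION ON THE LATTICE OF SUBFIELDS — EVERY ABELIAN CM FIELD WITH ONE ODD PRIME IN THE EXPONENT AND `2`-EXPONENT
`≤ 4`.**  Let `K` be a CM field, abelian over `ℚ`, with `g^{4p^k} = 1` on `Gal(K/ℚ)` (`p` an odd prime, `k` arbitrary; e.g. every
`ℚ(ζ_N)` with `(ℤ/N)ˣ ≅ (ℤ/2)^r × (ℤ/4)^s × P`, `P` a `p`-group: `N = 37, 57, 63, 74, 76, 81, 108, 109, 111, 135, 171, 189, 243, 324, …` and all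
the lane's earlier levels), and `Φ` ANY CM type of `K`.  Then `Φ` is NONDEGENERATE iff
(i) `Φ` is balanced (of Weil type) over NO imaginary quadratic subfield of `K`;
(ii) over NO CM subfield `F` with `Gal(F/ℚ) ≅ ℤ/4` does every embedding of `F` have exactly `[K:F]/2` extensions in `Φ`;
(iii) `Φ` is LEVEL of exponent `p` over NO CM subfield `F` with CYCLIC `Gal(F/ℚ)` and `p ∣ [F:ℚ]` — i.e. for no such `F` are the multiplicities
`#{φ ∈ Φ : φ|_F = τ}` constant along the orbits `τ ↦ τ ∘ σ` of the elements `σ ∈ Gal(F/ℚ)` with `σ^p = 1`.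
And then `B•(Aⁿ) ⊗ ℂ = D•(Aⁿ) ⊗ ℂ` and the Hodge conjecture hold for every power of every abelian variety of type `(K; Φ)` (§3).
[cite: Kubota1965, §4 Lemma 2] [cite: Hazama2003CyclicCM, Prop. 4.3 and Lemma 4.6.1] [cite: Dodson1984, §3.1.1 Theorem] [cite: Dodson1987, Prop. 4.4]
[cite: Gordon1999HodgeAVSurvey, 5.13 (ii), 9.4.1 and 9.4.3] [cite: Yanai2015IndexDegeneracy, Thm. 4.1 (proof, p. 818)] -/
theorem isNondegenerate_iff_forall_intermediateField [Fact p.Prime] (hp2 : p ≠ 2)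
    (hexp : ∀ g : K ≃ₐ[ℚ] K, g ^ (4 * p ^ k) = 1) (Φ : CMType K) :
    IsNondegenerate Φ ↔
      (∀ F : IntermediateField ℚ K, Module.finrank ℚ F = 2 → ¬ IsTotallyReal F →
        ¬ ∀ τ : F →+* ℂ, {φ : K →+* ℂ | φ.comp (algebraMap F K) = τ ∧ φ ∈ Φ.1}.ncard =
          {φ : K →+* ℂ | φ.comp (algebraMap F K) = τ ∧ φ ∉ Φ.1}.ncard) ∧
      (∀ F : IntermediateField ℚ K, Module.finrank ℚ F = 4 → ¬ IsTotallyReal F → IsCyclic (F ≃ₐ[ℚ] F) →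
        ¬ ∀ τ : F →+* ℂ, 2 * {φ : K →+* ℂ | φ.comp (algebraMap F K) = τ ∧ φ ∈ Φ.1}.ncard = Module.finrank F K) ∧
      (∀ F : IntermediateField ℚ K, ¬ IsTotallyReal F → IsCyclic (F ≃ₐ[ℚ] F) → p ∣ Module.finrank ℚ F →
        ¬ ∀ σ : F ≃ₐ[ℚ] F, σ ^ p = 1 → ∀ τ : F →+* ℂ,
          {φ : K →+* ℂ | φ.comp (algebraMap F K) = τ.comp σ.toRingEquiv.toRingHom ∧ φ ∈ Φ.1}.ncard =
            {φ : K →+* ℂ | φ.comp (algebraMap F K) = τ ∧ φ ∈ Φ.1}.ncard) := by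
  obtain ⟨φ₀⟩ := (inferInstance : Nonempty (K →+* ℂ))
  rw [isNondegenerate_iff hp2 φ₀ hexp Φ]
  refine and_congr ?_ (and_congr ?_ ?_)
  · -- (i) index `2` ↔ imaginary quadratic, evenly split ↔ balanced
    constructor
    · intro h F h2 hF hW
      have hρH : (conjGal : K ≃ₐ[ℚ] K) ∉ F.fixingSubgroup := (conjGal_not_mem_fixingSubgroup_iff F).2 hF
      exact h F.fixingSubgroup hρH (index_fixingSubgroup_eq_two F h2)
        ((card_filter_mem_eq_iff_balanced φ₀ Φ F h2 hF).2 hW)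
    · intro h H hρH hidx hsplit
      have h2 : Module.finrank ℚ (fixedField H) = 2 := by rw [finrank_fixedField_eq_index₄ₚₖ, hidx]
      have hF : ¬ IsTotallyReal (fixedField H) := (conjGal_not_mem_iff_not_isTotallyReal_fixedField H).1 hρH
      refine h (fixedField H) h2 hF ((card_filter_mem_eq_iff_balanced φ₀ Φ (fixedField H) h2 hF).1 ?_)
      simpa only [fixingSubgroup_fixedField] using hsplit
  · -- (ii) index `4`, cyclic quotient, halving ↔ cyclic quartic CM subfield, every embedding with `[K:F]/2` extensions
    constructor
    · intro h F h4 hF hcyc hW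
      exact h F.fixingSubgroup ((conjGal_not_mem_fixingSubgroup_iff F).2 hF)
        (by rw [CMNumbers.index_fixingSubgroup_eq_finrank F, h4]) ((isCyclic_quotient_fixingSubgroup_iff F).2 hcyc)
        ((forall_two_mul_card_filter_eq_iff_forall_fibre φ₀ Φ F).2 hW)
    · intro h H hρH hidx hcyc hhalf
      refine h (fixedField H) (by rw [finrank_fixedField_eq_index₄ₚₖ, hidx])
        ((conjGal_not_mem_iff_not_isTotallyReal_fixedField H).1 hρH) ((isCyclic_quotient_iff_isCyclic_gal_fixedField H).1 hcyc)
        ((forall_two_mul_card_filter_eq_iff_forall_fibre φ₀ Φ (fixedField H)).1 ?_)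
      simpa only [fixingSubgroup_fixedField] using hhalf
  · -- (iii) cyclic quotient with `p ∣` index, equidistributed ↔ cyclic CM subfield with `p ∣ [F:ℚ]`, level of exponent `p`
    constructor
    · intro h F hF hcyc hpd hL
      exact h F.fixingSubgroup ((conjGal_not_mem_fixingSubgroup_iff F).2 hF) ((isCyclic_quotient_fixingSubgroup_iff F).2 hcyc)
        (by rw [CMNumbers.index_fixingSubgroup_eq_finrank F]; exact hpd) ((forall_card_filter_eq_iff_level φ₀ Φ F).2 hL)
    · intro h H hρH hcyc hpd hE
      refine h (fixedField H) ((conjGal_not_mem_iff_not_isTotallyReal_fixedField H).1 hρH)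
        ((isCyclic_quotient_iff_isCyclic_gal_fixedField H).1 hcyc) (by rw [finrank_fixedField_eq_index₄ₚₖ]; exact hpd)
        ((forall_card_filter_eq_iff_level φ₀ Φ (fixedField H)).1 ?_)
      simpa only [fixingSubgroup_fixedField] using hE

/-- **Conversely: a CM subfield with cyclic Galois group of degree divisible by `p` over which `Φ` is level of exponent `p` makes the type
DEGENERATE** (it costs `φ([F:ℚ])` in rank). [cite: Kubota1965, §4 Lemma 2] [cite: Hazama2003CyclicCM, Prop. 4.3 and Lemma 4.6.1] -/
theorem not_isNondegenerate_of_level_of_isCyclic [Fact p.Prime] (hp2 : p ≠ 2)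
    (hexp : ∀ g : K ≃ₐ[ℚ] K, g ^ (4 * p ^ k) = 1) (Φ : CMType K) (F : IntermediateField ℚ K)
    (hF : ¬ IsTotallyReal F) (hcyc : IsCyclic (F ≃ₐ[ℚ] F)) (hpd : p ∣ Module.finrank ℚ F)
    (hlev : ∀ σ : F ≃ₐ[ℚ] F, σ ^ p = 1 → ∀ τ : F →+* ℂ,
      {φ : K →+* ℂ | φ.comp (algebraMap F K) = τ.comp σ.toRingEquiv.toRingHom ∧ φ ∈ Φ.1}.ncard =
        {φ : K →+* ℂ | φ.comp (algebraMap F K) = τ ∧ φ ∈ Φ.1}.ncard) : ¬ IsNondegenerate Φ := by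
  rw [isNondegenerate_iff_forall_intermediateField hp2 hexp Φ]
  exact fun h => h.2.2 F hF hcyc hpd hlev

end Field

/-! ## §3 Consequences for abelian varieties: `B•(Aⁿ) ⊗ ℂ = D•(Aⁿ) ⊗ ℂ` and the Hodge conjecture for all powers -/

section Varieties

open Literature.AlgebraicGeometry.Motives (AbelianVariety)
open Literature.AlgebraicGeometry.HodgeTheory
open Literature.AlgebraicGeometry.ComplexMultiplication (IsCMTypeRealisation)
open Literature.AlgebraicGeometry.VanGeemen1994 (hodgeClassSpan)
open Literature.Barriers.HodgeConjecture (divisorClassesSpan)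
open _root_.CategoryTheory _root_.CategoryTheory.Limits

variable {K : Type} [Field K] [NumberField K] [IsCMField K] [IsAbelianGalois ℚ K] {p k : ℕ}
  {Φ : CMType K} {A : AbelianVariety ℂ} {ι : 𝓞 K →+* End A} {θ : K →+* Module.End ℂ (complexBetti A.X 1)}

/-- `Bᵐ ⊗ ℂ = Dᵐ ⊗ ℂ` for all `m` on an abelian variety gives the Hodge conjecture for it (Lefschetz `(1,1)`, cup products, tree
theorems). [cite: Gordon1999HodgeAVSurvey, §9.3] -/
private theorem hodgeConjectureFor_of_forall_hodgeClassSpan_eq₄ₚₖ (B : AbelianVariety ℂ)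
    (h : ∀ m : ℕ, hodgeClassSpan B.dim B.X m = divisorClassesSpan B.X B.dim m) : HodgeConjectureFor B.dim B.X :=
  ⟨nonempty_hodgeModel_holds (Motives.AbelianVariety.isSmoothProjective_holds (A := B)),
    fun m _ hc hmm ↦ AbelianVariety.divisorClassesSpan_le_algebraicClasses B
      (fun b hb hb' ↦ lefschetzOneOne_rational_holds (Motives.AbelianVariety.isSmoothProjective_holds (A := B)) b hb hb') m
      ((h m) ▸ Submodule.subset_span ⟨hc, hmm⟩)⟩

/-- **`B•(Aⁿ) ⊗ ℂ = D•(Aⁿ) ⊗ ℂ` FOR EVERY REALISATION OF A TYPE SATISFYING THE THREE-CLAUSE CRITERION** (`K` abelian CM with `g^{4p^k} = 1`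
on `Gal(K/ℚ)`). [cite: Kubota1965, §4 Lemma 2] [cite: Gordon1999HodgeAVSurvey, Thm. 6.4 and §9.3] [cite: Hazama2003CyclicCM, Prop. 4.3] -/
theorem hodgeClassSpan_pow_eq_divisorClassesSpan_of_forall_intermediateField [Fact p.Prime] (hp2 : p ≠ 2)
    (hexp : ∀ g : K ≃ₐ[ℚ] K, g ^ (4 * p ^ k) = 1)
    (hW : ∀ F : IntermediateField ℚ K, Module.finrank ℚ F = 2 → ¬ IsTotallyReal F →
        ¬ ∀ τ : F →+* ℂ, {φ : K →+* ℂ | φ.comp (algebraMap F K) = τ ∧ φ ∈ Φ.1}.ncard =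
          {φ : K →+* ℂ | φ.comp (algebraMap F K) = τ ∧ φ ∉ Φ.1}.ncard)
    (hQ : ∀ F : IntermediateField ℚ K, Module.finrank ℚ F = 4 → ¬ IsTotallyReal F → IsCyclic (F ≃ₐ[ℚ] F) →
        ¬ ∀ τ : F →+* ℂ, 2 * {φ : K →+* ℂ | φ.comp (algebraMap F K) = τ ∧ φ ∈ Φ.1}.ncard = Module.finrank F K)
    (hL : ∀ F : IntermediateField ℚ K, ¬ IsTotallyReal F → IsCyclic (F ≃ₐ[ℚ] F) → p ∣ Module.finrank ℚ F →
        ¬ ∀ σ : F ≃ₐ[ℚ] F, σ ^ p = 1 → ∀ τ : F →+* ℂ,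
          {φ : K →+* ℂ | φ.comp (algebraMap F K) = τ.comp σ.toRingEquiv.toRingHom ∧ φ ∈ Φ.1}.ncard =
            {φ : K →+* ℂ | φ.comp (algebraMap F K) = τ ∧ φ ∈ Φ.1}.ncard)
    (hA : IsCMTypeRealisation Φ A ι θ) (n m : ℕ) :
    hodgeClassSpan (⨁ fun _ : Fin n => A).dim (⨁ fun _ : Fin n => A).X m =
      divisorClassesSpan (⨁ fun _ : Fin n => A).X (⨁ fun _ : Fin n => A).dim m :=
  ((isNondegenerate_iff_forall_intermediateField hp2 hexp Φ).2 ⟨hW, hQ, hL⟩).hodgeClassSpan_pow_eq_divisorClassesSpan hA n m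

/-- **THE HODGE CONJECTURE FOR ALL POWERS OF EVERY REALISATION OF A TYPE SATISFYING THE THREE-CLAUSE CRITERION** (every abelian CM field with
one odd prime in the exponent of its Galois group and `2`-exponent `≤ 4`) — UNCONDITIONAL, any realisation.
[cite: Gordon1999HodgeAVSurvey, Thm. 6.4 and §9.3] [cite: Kubota1965, §4 Lemma 2] [cite: Deligne2000, §1] -/
theorem hodgeConjectureFor_pow_of_forall_intermediateField [Fact p.Prime] (hp2 : p ≠ 2)
    (hexp : ∀ g : K ≃ₐ[ℚ] K, g ^ (4 * p ^ k) = 1)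
    (hW : ∀ F : IntermediateField ℚ K, Module.finrank ℚ F = 2 → ¬ IsTotallyReal F →
        ¬ ∀ τ : F →+* ℂ, {φ : K →+* ℂ | φ.comp (algebraMap F K) = τ ∧ φ ∈ Φ.1}.ncard =
          {φ : K →+* ℂ | φ.comp (algebraMap F K) = τ ∧ φ ∉ Φ.1}.ncard)
    (hQ : ∀ F : IntermediateField ℚ K, Module.finrank ℚ F = 4 → ¬ IsTotallyReal F → IsCyclic (F ≃ₐ[ℚ] F) →
        ¬ ∀ τ : F →+* ℂ, 2 * {φ : K →+* ℂ | φ.comp (algebraMap F K) = τ ∧ φ ∈ Φ.1}.ncard = Module.finrank F K)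
    (hL : ∀ F : IntermediateField ℚ K, ¬ IsTotallyReal F → IsCyclic (F ≃ₐ[ℚ] F) → p ∣ Module.finrank ℚ F →
        ¬ ∀ σ : F ≃ₐ[ℚ] F, σ ^ p = 1 → ∀ τ : F →+* ℂ,
          {φ : K →+* ℂ | φ.comp (algebraMap F K) = τ.comp σ.toRingEquiv.toRingHom ∧ φ ∈ Φ.1}.ncard =
            {φ : K →+* ℂ | φ.comp (algebraMap F K) = τ ∧ φ ∈ Φ.1}.ncard)
    (hA : IsCMTypeRealisation Φ A ι θ) (n : ℕ) :
    HodgeConjectureFor (⨁ fun _ : Fin n => A).dim (⨁ fun _ : Fin n => A).X :=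
  hodgeConjectureFor_of_forall_hodgeClassSpan_eq₄ₚₖ _
    fun m ↦ hodgeClassSpan_pow_eq_divisorClassesSpan_of_forall_intermediateField hp2 hexp hW hQ hL hA n m

/-- **No power of such an `A` carries an exceptional Hodge class.** [cite: Gordon1999HodgeAVSurvey, Thm. 6.4] -/
theorem not_exists_exceptional_pow_of_forall_intermediateField [Fact p.Prime] (hp2 : p ≠ 2)
    (hexp : ∀ g : K ≃ₐ[ℚ] K, g ^ (4 * p ^ k) = 1)
    (hW : ∀ F : IntermediateField ℚ K, Module.finrank ℚ F = 2 → ¬ IsTotallyReal F →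
        ¬ ∀ τ : F →+* ℂ, {φ : K →+* ℂ | φ.comp (algebraMap F K) = τ ∧ φ ∈ Φ.1}.ncard =
          {φ : K →+* ℂ | φ.comp (algebraMap F K) = τ ∧ φ ∉ Φ.1}.ncard)
    (hQ : ∀ F : IntermediateField ℚ K, Module.finrank ℚ F = 4 → ¬ IsTotallyReal F → IsCyclic (F ≃ₐ[ℚ] F) →
        ¬ ∀ τ : F →+* ℂ, 2 * {φ : K →+* ℂ | φ.comp (algebraMap F K) = τ ∧ φ ∈ Φ.1}.ncard = Module.finrank F K)
    (hL : ∀ F : IntermediateField ℚ K, ¬ IsTotallyReal F → IsCyclic (F ≃ₐ[ℚ] F) → p ∣ Module.finrank ℚ F →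
        ¬ ∀ σ : F ≃ₐ[ℚ] F, σ ^ p = 1 → ∀ τ : F →+* ℂ,
          {φ : K →+* ℂ | φ.comp (algebraMap F K) = τ.comp σ.toRingEquiv.toRingHom ∧ φ ∈ Φ.1}.ncard =
            {φ : K →+* ℂ | φ.comp (algebraMap F K) = τ ∧ φ ∈ Φ.1}.ncard)
    (hA : IsCMTypeRealisation Φ A ι θ) (n m : ℕ) :
    ¬ ∃ c : complexBetti (⨁ fun _ : Fin n => A).X (2 * m), IsRationalClass c ∧
        IsOfHodgeType (⨁ fun _ : Fin n => A).dim (⨁ fun _ : Fin n => A).X (2 * m) m m c ∧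
        c ∉ divisorClassesSpan (⨁ fun _ : Fin n => A).X (⨁ fun _ : Fin n => A).dim m := by
  rintro ⟨c, hcQ, hcH, hcD⟩
  exact hcD ((hodgeClassSpan_pow_eq_divisorClassesSpan_of_forall_intermediateField hp2 hexp hW hQ hL hA n m) ▸
    Submodule.subset_span ⟨hcQ, hcH⟩)

end Varieties

/-! ## §4 Cyclotomic fields `ℚ(ζ_q)` with `u^{4p^k} = 1` on `(ℤ/q)ˣ`; the level `109` (`ℤ/108 = ℤ/4 × ℤ/27`, exponent `4·3³`) -/

section Cyclotomic

open Literature.AlgebraicGeometry.Motives (AbelianVariety)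
open Literature.AlgebraicGeometry.HodgeTheory
open Literature.AlgebraicGeometry.ComplexMultiplication (IsCMTypeRealisation)
open _root_.CategoryTheory _root_.CategoryTheory.Limits
open Polynomial

variable {q p k : ℕ} {L : Type} [Field L] [NumberField L]
  {Φ : CMType L} {A : AbelianVariety ℂ} {ι : 𝓞 L →+* End A} {θ : L →+* Module.End ℂ (complexBetti A.X 1)}

/-- **Nondegeneracy criterion for `ℚ(ζ_q)`, `(ℤ/q)ˣ` of exponent dividing `4p^k`.** [cite: Kubota1965, §4 Lemma 2] [cite: Hazama2003CyclicCM, Prop. 4.3]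
[cite: Dodson1984, §3.1.1 Theorem] [cite: Dodson1987, Prop. 4.4] [cite: Gordon1999HodgeAVSurvey, 9.4.3] -/
theorem isNondegenerate_iff_of_isCyclotomicExtension [NeZero q] [IsCyclotomicExtension {q} ℚ L]
    (h2q : 2 < q) [Fact p.Prime] (hp2 : p ≠ 2) (hq : ∀ u : (ZMod q)ˣ, u ^ (4 * p ^ k) = 1) (Φ : CMType L) :
    IsNondegenerate Φ ↔
      (∀ F : IntermediateField ℚ L, Module.finrank ℚ F = 2 → ¬ IsTotallyReal F →
        ¬ ∀ τ : F →+* ℂ, {φ : L →+* ℂ | φ.comp (algebraMap F L) = τ ∧ φ ∈ Φ.1}.ncard =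
          {φ : L →+* ℂ | φ.comp (algebraMap F L) = τ ∧ φ ∉ Φ.1}.ncard) ∧
      (∀ F : IntermediateField ℚ L, Module.finrank ℚ F = 4 → ¬ IsTotallyReal F → IsCyclic (F ≃ₐ[ℚ] F) →
        ¬ ∀ τ : F →+* ℂ, 2 * {φ : L →+* ℂ | φ.comp (algebraMap F L) = τ ∧ φ ∈ Φ.1}.ncard = Module.finrank F L) ∧
      (∀ F : IntermediateField ℚ L, ¬ IsTotallyReal F → IsCyclic (F ≃ₐ[ℚ] F) → p ∣ Module.finrank ℚ F →
        ¬ ∀ σ : F ≃ₐ[ℚ] F, σ ^ p = 1 → ∀ τ : F →+* ℂ,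
          {φ : L →+* ℂ | φ.comp (algebraMap F L) = τ.comp σ.toRingEquiv.toRingHom ∧ φ ∈ Φ.1}.ncard =
            {φ : L →+* ℂ | φ.comp (algebraMap F L) = τ ∧ φ ∈ Φ.1}.ncard) := by
  obtain ⟨hcm, hab, hexp, -⟩ := cm_abelian_pow_eq_one_of_isCyclotomicExtension h2q hq L
  haveI := hcm; haveI := hab
  exact isNondegenerate_iff_forall_intermediateField hp2 hexp Φ

/-- **The Hodge conjecture for all powers of every realisation of a type of `ℚ(ζ_q)`** (`(ℤ/q)ˣ` of exponent dividing `4p^k`) **satisfying the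
three-clause criterion** — UNCONDITIONAL. [cite: Gordon1999HodgeAVSurvey, Thm. 6.4 and §9.3] [cite: Kubota1965, §4 Lemma 2] -/
theorem hodgeConjectureFor_pow_of_forall_of_isCyclotomicExtension [NeZero q] [IsCyclotomicExtension {q} ℚ L]
    (h2q : 2 < q) [Fact p.Prime] (hp2 : p ≠ 2) (hq : ∀ u : (ZMod q)ˣ, u ^ (4 * p ^ k) = 1)
    (hW : ∀ F : IntermediateField ℚ L, Module.finrank ℚ F = 2 → ¬ IsTotallyReal F →
        ¬ ∀ τ : F →+* ℂ, {φ : L →+* ℂ | φ.comp (algebraMap F L) = τ ∧ φ ∈ Φ.1}.ncard =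
          {φ : L →+* ℂ | φ.comp (algebraMap F L) = τ ∧ φ ∉ Φ.1}.ncard)
    (hQ : ∀ F : IntermediateField ℚ L, Module.finrank ℚ F = 4 → ¬ IsTotallyReal F → IsCyclic (F ≃ₐ[ℚ] F) →
        ¬ ∀ τ : F →+* ℂ, 2 * {φ : L →+* ℂ | φ.comp (algebraMap F L) = τ ∧ φ ∈ Φ.1}.ncard = Module.finrank F L)
    (hL : ∀ F : IntermediateField ℚ L, ¬ IsTotallyReal F → IsCyclic (F ≃ₐ[ℚ] F) → p ∣ Module.finrank ℚ F →
        ¬ ∀ σ : F ≃ₐ[ℚ] F, σ ^ p = 1 → ∀ τ : F →+* ℂ,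
          {φ : L →+* ℂ | φ.comp (algebraMap F L) = τ.comp σ.toRingEquiv.toRingHom ∧ φ ∈ Φ.1}.ncard =
            {φ : L →+* ℂ | φ.comp (algebraMap F L) = τ ∧ φ ∈ Φ.1}.ncard)
    (hA : IsCMTypeRealisation Φ A ι θ) (n : ℕ) :
    HodgeConjectureFor (⨁ fun _ : Fin n => A).dim (⨁ fun _ : Fin n => A).X := by
  obtain ⟨hcm, hab, hexp, -⟩ := cm_abelian_pow_eq_one_of_isCyclotomicExtension h2q hq L
  haveI := hcm; haveI := hab
  exact hodgeConjectureFor_pow_of_forall_intermediateField hp2 hexp hW hQ hL hA n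

/-- `u¹⁰⁸ = 1` for every unit of `ℤ/109`: Euler (`φ(109) = 108 = 4·3³`; `(ℤ/109)ˣ ≅ ℤ/108` cyclic). [cite: Washington1997, Ch. 2 Thm. 2.5] -/
theorem units_pow_oneHundredEight_oneHundredNine (u : (ZMod 109)ˣ) : u ^ (4 * 3 ^ 3) = 1 := by
  have h := ZMod.pow_totient u
  rw [show Nat.totient 109 = 108 by decide] at h
  rw [show (4 * 3 ^ 3 : ℕ) = 108 by norm_num]
  exact h

/-- **`ℚ(ζ₁₀₉)` (degree `108`, `Gal ≅ ℤ/108` cyclic — beyond the lane's `k ≤ 2` rank formulas): THE HODGE CONJECTURE FOR ALL POWERS of every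
abelian variety with complex multiplication by `ℚ(ζ₁₀₉)` (CM `54`-folds) whose type halves no cyclic quartic CM subfield and is level of exponent
`3` over no CM subfield of degree divisible by `3` (here: the CM subfields of degree `12, 36, 108`; the subfields of degree `2, 6, 18, 54` are
real)** — UNCONDITIONAL. [cite: Gordon1999HodgeAVSurvey, Thm. 6.4 and §9.3] [cite: Kubota1965, §4 Lemma 2] [cite: Dodson1987, Prop. 4.4] -/
theorem hodgeConjectureFor_pow_of_forall_oneHundredNine [IsCyclotomicExtension {109} ℚ L]
    (hW : ∀ F : IntermediateField ℚ L, Module.finrank ℚ F = 2 → ¬ IsTotallyReal F →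
        ¬ ∀ τ : F →+* ℂ, {φ : L →+* ℂ | φ.comp (algebraMap F L) = τ ∧ φ ∈ Φ.1}.ncard =
          {φ : L →+* ℂ | φ.comp (algebraMap F L) = τ ∧ φ ∉ Φ.1}.ncard)
    (hQ : ∀ F : IntermediateField ℚ L, Module.finrank ℚ F = 4 → ¬ IsTotallyReal F → IsCyclic (F ≃ₐ[ℚ] F) →
        ¬ ∀ τ : F →+* ℂ, 2 * {φ : L →+* ℂ | φ.comp (algebraMap F L) = τ ∧ φ ∈ Φ.1}.ncard = Module.finrank F L)
    (hL : ∀ F : IntermediateField ℚ L, ¬ IsTotallyReal F → IsCyclic (F ≃ₐ[ℚ] F) → 3 ∣ Module.finrank ℚ F →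
        ¬ ∀ σ : F ≃ₐ[ℚ] F, σ ^ (3 : ℕ) = AlgEquiv.refl → ∀ τ : F →+* ℂ,
          {φ : L →+* ℂ | φ.comp (algebraMap F L) = τ.comp σ.toRingEquiv.toRingHom ∧ φ ∈ Φ.1}.ncard =
            {φ : L →+* ℂ | φ.comp (algebraMap F L) = τ ∧ φ ∈ Φ.1}.ncard)
    (hA : IsCMTypeRealisation Φ A ι θ) (n : ℕ) :
    HodgeConjectureFor (⨁ fun _ : Fin n => A).dim (⨁ fun _ : Fin n => A).X :=
  haveI : Fact (Nat.Prime 3) := ⟨Nat.prime_three⟩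
  hodgeConjectureFor_pow_of_forall_of_isCyclotomicExtension (q := 109) (k := 3) (by norm_num) (by decide)
    units_pow_oneHundredEight_oneHundredNine hW hQ hL hA n

end Cyclotomic

end ExponentFourTimesPrimePower

end Literature.AlgebraicGeometry.Pohlmann1968

end
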